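import Mathlib
import Literature.Analysis.FluidPDE.LerayHopf
import Summits.NavierStokesRegularity.NavierStokesRegularity.Theorems.CalmPocketDoorDefs
import HarnessLib

/-!
# Door S32 «CalmPocketDoor» (stmt-NavierStokesRegularity-0056, ROUND-30), plate I32:
# THE LERAY–HOPF TERMINAL VALUE IS THE UNIFORM TRACE, a.e. ON THE SHELL

Text of record: nsreg-p1 `r30/Sketch32.lean` v2 (sha16 d8e333116c9f1838), lines 145–150, `def TerminalValueIdentification`, with
`shell R := {x | 1/2 ≤ ‖x‖ ∧ ‖x‖ ≤ R}` UNFOLDED and `E³ = EuclideanSpace ℝ (Fin 3)` spelled out (no local notation).  KEY: LEAD S-door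
ns-s30-p1 g2, 2026-08-28 (PLATE-AID-32 §I32).

* `terminalValue_ae_eq` — for a Leray–Hopf solution `u` on `[0,1]` (`IsLerayHopfOn 1 1 0 (u 0) u`) whose slices `u t`, `t ∈ (0,1)`, are
  continuous on the shell and converge UNIFORMLY there to `U₁` as `t ↑ 1`, the Leray–Hopf value satisfies `u 1 = U₁` a.e. on the shell.
  Proof: for a smooth test `g` supported in the OPEN shell `{1/2 < ‖x‖ < R}` and a vector `e`, the pairing `t ↦ ∫ ⟪u t, g • e⟫ = ∫ g ⟪u t, e⟫`
  is continuous on `(0,1]` (field `weak_continuous`, `g • e ∈ L²`), so it tends to `∫ g ⟪u 1, e⟫` along `𝓝[<] 1`; by the uniform convergence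
  on the (compact) support it also tends to `∫ g ⟪U₁, e⟫`; limits are unique, so `⟪∫ g • (u 1 − U₁), e⟫ = 0` for every `e`, i.e.
  `∫ g • (u 1 − U₁) = 0`; Mathlib's `IsOpen.ae_eq_zero_of_integral_contDiff_smul_eq_zero` gives `u 1 = U₁` a.e. on the open shell, and the
  two boundary spheres are null (`Measure.addHaar_sphere`).

After P0 `Theorems/CalmPocketDoorDefs.lean` lands, the one-liner `terminalValueIdentification_holds : TerminalValueIdentification :=
terminalValue_ae_eq` closes plate I32 by name (glue checked rc 0 against a verbatim copy of the Sketch32 def).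

WHAT THIS IS NOT: not NS regularity, not the door — a routine measure-theoretic plate `--supports` stmt-0056 (S32 is a regularity CRITERION;
0056 is NOT proved). [folklore; cite: Galdi2000, Lemma 2.2 (weak `L²` continuity of Leray–Hopf solutions)]
-/

noncomputable section

set_option linter.dupNamespace false

open MeasureTheory Set Filter Topology Metric Function
open scoped NNReal ENNReal RealInnerProductSpace Topology ContDiff

namespace Summit.NavierStokesRegularity.NavierStokesRegularity.Theorems.CalmPocketDoor

open Literature.Analysis Literature.Analysis.FluidPDE

/-! ### Two measure-theoretic helpers -/

/-- The closed shell minus the open shell lies in two spheres, hence is null. [folklore] -/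
theorem ae_mem_openShell_of_mem_shell (R : ℝ) :
    ∀ᵐ x : EuclideanSpace ℝ (Fin 3) ∂volume, x ∈ {x : EuclideanSpace ℝ (Fin 3) | 1 / 2 ≤ ‖x‖ ∧ ‖x‖ ≤ R} →
      x ∈ {x : EuclideanSpace ℝ (Fin 3) | 1 / 2 < ‖x‖ ∧ ‖x‖ < R} := by
  have h1 : volume (sphere (0 : EuclideanSpace ℝ (Fin 3)) (1 / 2)) = 0 := Measure.addHaar_sphere volume 0 _
  have h2 : volume (sphere (0 : EuclideanSpace ℝ (Fin 3)) R) = 0 := Measure.addHaar_sphere volume 0 _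
  have h : volume (sphere (0 : EuclideanSpace ℝ (Fin 3)) (1 / 2) ∪ sphere (0 : EuclideanSpace ℝ (Fin 3)) R) = 0 :=
    measure_union_null h1 h2
  filter_upwards [measure_eq_zero_iff_ae_notMem.1 h] with x hx hxs
  rw [mem_union, not_or, mem_sphere, mem_sphere, dist_zero_right] at hx
  exact ⟨lt_of_le_of_ne hxs.1 (fun h => hx.1 h.symm), lt_of_le_of_ne hxs.2 hx.2⟩

/-- The open shell is open. [folklore] -/
theorem isOpen_openShell (R : ℝ) : IsOpen {x : EuclideanSpace ℝ (Fin 3) | 1 / 2 < ‖x‖ ∧ ‖x‖ < R} :=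
  (isOpen_lt continuous_const continuous_norm).inter (isOpen_lt continuous_norm continuous_const)

/-! ### Pairings against a compactly supported continuous test function -/

variable {u : ℝ → EuclideanSpace ℝ (Fin 3) → EuclideanSpace ℝ (Fin 3)} {U₁ : EuclideanSpace ℝ (Fin 3) → EuclideanSpace ℝ (Fin 3)}

/-- **Uniform convergence passes to the pairing.**  If `u t → U₁` uniformly on a set `S` along a filter `l`, the slices `u t` are eventually
continuous on `S`, and `g` is continuous with compact support inside `S`, then `∫ g ⟪u t, e⟫ → ∫ g ⟪U₁, e⟫` along `l`. [folklore] -/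
theorem tendsto_integral_mul_inner_of_tendstoUniformlyOn {l : Filter ℝ} [l.NeBot] {S : Set (EuclideanSpace ℝ (Fin 3))}
    (hcont : ∀ᶠ t in l, ContinuousOn (u t) S) (hunif : TendstoUniformlyOn (fun t => u t) U₁ l S)
    {g : EuclideanSpace ℝ (Fin 3) → ℝ} (hg : Continuous g) (hgc : HasCompactSupport g) (hgS : tsupport g ⊆ S)
    (e : EuclideanSpace ℝ (Fin 3)) :
    Tendsto (fun t => ∫ x, g x * ⟪u t x, e⟫) l (𝓝 (∫ x, g x * ⟪U₁ x, e⟫)) := by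
  set K : Set (EuclideanSpace ℝ (Fin 3)) := tsupport g with hK
  have hKc : IsCompact K := hgc
  have hKm : MeasurableSet K := (isClosed_tsupport g).measurableSet
  have hKfin : volume K < ⊤ := hKc.measure_lt_top
  -- `U₁` is continuous on `S`
  have hU₁ : ContinuousOn U₁ S := hunif.continuousOn hcont.frequently
  -- a bound for `g`
  obtain ⟨Cg, hCg⟩ := hg.bounded_above_of_compact_support hgc
  have hCg0 : 0 ≤ Cg := (norm_nonneg _).trans (hCg 0)
  -- all integrals live on `K`
  have hoff : ∀ (φ : EuclideanSpace ℝ (Fin 3) → EuclideanSpace ℝ (Fin 3)) (x : EuclideanSpace ℝ (Fin 3)), x ∉ K →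
      g x * ⟪φ x, e⟫ = 0 := fun φ x hx => by rw [image_eq_zero_of_notMem_tsupport hx, zero_mul]
  have hset : ∀ φ : EuclideanSpace ℝ (Fin 3) → EuclideanSpace ℝ (Fin 3),
      ∫ x, g x * ⟪φ x, e⟫ = ∫ x in K, g x * ⟪φ x, e⟫ := fun φ =>
    (setIntegral_eq_integral_of_forall_compl_eq_zero fun x hx => hoff φ x hx).symm
  rw [Metric.tendsto_nhds]
  intro ε hε
  -- uniform closeness on `S ⊇ K`
  set η : ℝ := ε / (2 * ((Cg * ‖e‖ + 1) * ((volume K).toReal + 1))) with hη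
  have hη0 : 0 < η := by positivity
  have hclose := (Metric.tendstoUniformlyOn_iff.1 hunif) η hη0
  filter_upwards [hclose, hcont] with t ht htc
  rw [hset (u t), hset U₁, dist_eq_norm, ← integral_sub]
  rotate_left
  · exact ((hg.continuousOn.mul ((htc.mono hgS).inner continuousOn_const)).integrableOn_compact hKc)
  · exact ((hg.continuousOn.mul ((hU₁.mono hgS).inner continuousOn_const)).integrableOn_compact hKc)
  have hbound : ∀ x ∈ K, ‖g x * ⟪u t x, e⟫ - g x * ⟪U₁ x, e⟫‖ ≤ Cg * ‖e‖ * η := by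
    intro x hx
    rw [← mul_sub, ← inner_sub_left, norm_mul]
    have h1 : ‖⟪u t x - U₁ x, e⟫‖ ≤ ‖u t x - U₁ x‖ * ‖e‖ := norm_inner_le_norm _ _
    have h2 : ‖u t x - U₁ x‖ ≤ η := by
      rw [← dist_eq_norm, dist_comm]; exact (ht x (hgS hx)).le
    calc ‖g x‖ * ‖⟪u t x - U₁ x, e⟫‖ ≤ Cg * (‖u t x - U₁ x‖ * ‖e‖) := by gcongr; exact hCg x
      _ ≤ Cg * (η * ‖e‖) := by gcongr
      _ = Cg * ‖e‖ * η := by ring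
  have hV : 0 ≤ (volume K).toReal := ENNReal.toReal_nonneg
  have hA : 0 ≤ Cg * ‖e‖ := by positivity
  calc ‖∫ x in K, g x * ⟪u t x, e⟫ - g x * ⟪U₁ x, e⟫‖ ≤ Cg * ‖e‖ * η * (volume K).toReal :=
        norm_setIntegral_le_of_norm_le_const hKfin hbound
    _ ≤ (Cg * ‖e‖ + 1) * η * ((volume K).toReal + 1) := by nlinarith [mul_nonneg hA hV, hη0.le]
    _ = ε / 2 := by
        rw [hη]
        field_simp
    _ < ε := by linarith

/-- **Weak `L²` continuity passes to the pairing at `t = 1`.**  For a Leray–Hopf solution on `[0,1]` and a continuous compactly supported `g`: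
`∫ g ⟪u t, e⟫ → ∫ g ⟪u 1, e⟫` as `t ↑ 1` (field `weak_continuous` with `w = g • e ∈ L²`; `𝓝[<] 1 = 𝓝[(0,1)] 1 ≤ 𝓝[(0,1]] 1`). [cite: Galdi2000, Lemma 2.2] -/
theorem tendsto_integral_mul_inner_of_isLerayHopfOn (hLH : IsLerayHopfOn 1 1 0 (u 0) u)
    {g : EuclideanSpace ℝ (Fin 3) → ℝ} (hg : Continuous g) (hgc : HasCompactSupport g) (e : EuclideanSpace ℝ (Fin 3)) :
    Tendsto (fun t => ∫ x, g x * ⟪u t x, e⟫) (𝓝[<] (1 : ℝ)) (𝓝 (∫ x, g x * ⟪u 1 x, e⟫)) := by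
  have hwc' : HasCompactSupport fun x => g x • e := by
    refine hgc.mono fun x hx => ?_
    rw [Function.mem_support] at hx ⊢
    contrapose! hx
    rw [hx, zero_smul]
  have hw : MemLp (fun x => g x • e) 2 volume := (hg.smul continuous_const).memLp_of_hasCompactSupport hwc'
  have hwc := (hLH.weak_continuous (fun x => g x • e) hw).1
  have hpair : ∀ t, ∫ x, ⟪u t x, g x • e⟫ = ∫ x, g x * ⟪u t x, e⟫ := fun t => by
    refine integral_congr_ae (Eventually.of_forall fun x => ?_)
    simp only [real_inner_smul_right]
  have hcw : ContinuousWithinAt (fun t => ∫ x, ⟪u t x, g x • e⟫) (Ioc 0 1) 1 := hwc 1 ⟨zero_lt_one, le_rfl⟩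
  have h2 : Tendsto (fun t => ∫ x, ⟪u t x, g x • e⟫) (𝓝[<] (1 : ℝ)) (𝓝 (∫ x, ⟪u 1 x, g x • e⟫)) := by
    rw [← nhdsWithin_Ioo_eq_nhdsLT zero_lt_one]
    exact hcw.tendsto.mono_left (nhdsWithin_mono _ Ioo_subset_Ioc_self)
  simpa only [hpair] using h2

/-- From the scalar pairings to the vector integral: if `g • f₁`, `g • f₂` are integrable and `∫ g ⟪f₁, e⟫ = ∫ g ⟪f₂, e⟫` for every `e`, then
`∫ g • (f₁ − f₂) = 0`. [folklore] -/
theorem integral_smul_sub_eq_zero {f₁ f₂ : EuclideanSpace ℝ (Fin 3) → EuclideanSpace ℝ (Fin 3)} {g : EuclideanSpace ℝ (Fin 3) → ℝ}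
    (h₁ : Integrable (fun x => g x • f₁ x)) (h₂ : Integrable (fun x => g x • f₂ x))
    (hdir : ∀ e : EuclideanSpace ℝ (Fin 3), ∫ x, g x * ⟪f₁ x, e⟫ = ∫ x, g x * ⟪f₂ x, e⟫) :
    ∫ x, g x • (f₁ x - f₂ x) = 0 := by
  have hint : Integrable (fun x => g x • (f₁ x - f₂ x)) := by
    have := h₁.sub h₂
    refine this.congr (Eventually.of_forall fun x => ?_)
    simp only [Pi.sub_apply, smul_sub]
  refine integral_eq_zero_of_forall_integral_inner_eq_zero ℝ _ hint fun c => ?_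
  have e1 : ∀ x, ⟪c, g x • (f₁ x - f₂ x)⟫ = g x * ⟪f₁ x, c⟫ - g x * ⟪f₂ x, c⟫ := fun x => by
    rw [real_inner_smul_right, inner_sub_right, real_inner_comm (f₁ x) c, real_inner_comm (f₂ x) c]; ring
  have i1 : Integrable fun x => g x * ⟪f₁ x, c⟫ := by
    have := h₁.inner_const (𝕜 := ℝ) c
    refine this.congr (Eventually.of_forall fun x => ?_)
    simp only [real_inner_smul_left]
  have i2 : Integrable fun x => g x * ⟪f₂ x, c⟫ := by
    have := h₂.inner_const (𝕜 := ℝ) c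
    refine this.congr (Eventually.of_forall fun x => ?_)
    simp only [real_inner_smul_left]
  simp_rw [e1]
  rw [integral_sub i1 i2, hdir c, sub_self]

/-! ### The plate -/

/-- **PLATE I32 · TERMINAL VALUE = TRACE a.e.** (Sketch32 `TerminalValueIdentification`, unfolded): the Leray–Hopf value `u 1` (weak `L²`
continuity at `t = 1`) agrees a.e. on the shell `{1/2 ≤ ‖x‖ ≤ R}` with the uniform limit `U₁` of the continuous slices `u t`, `t ↑ 1`.
[folklore; cite: Galdi2000, Lemma 2.2] -/
theorem terminalValue_ae_eq :
    ∀ (u : ℝ → EuclideanSpace ℝ (Fin 3) → EuclideanSpace ℝ (Fin 3)) (R : ℝ)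
      (U₁ : EuclideanSpace ℝ (Fin 3) → EuclideanSpace ℝ (Fin 3)), IsLerayHopfOn 1 1 0 (u 0) u →
      (∀ t ∈ Ioo (0 : ℝ) 1, ContinuousOn (u t) {x : EuclideanSpace ℝ (Fin 3) | 1 / 2 ≤ ‖x‖ ∧ ‖x‖ ≤ R}) →
      TendstoUniformlyOn (fun t => u t) U₁ (𝓝[<] (1 : ℝ)) {x : EuclideanSpace ℝ (Fin 3) | 1 / 2 ≤ ‖x‖ ∧ ‖x‖ ≤ R} →
      ∀ᵐ x ∂(volume.restrict {x : EuclideanSpace ℝ (Fin 3) | 1 / 2 ≤ ‖x‖ ∧ ‖x‖ ≤ R}), u 1 x = U₁ x := by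
  intro u R U₁ hLH hcont hunif
  set S : Set (EuclideanSpace ℝ (Fin 3)) := {x | 1 / 2 ≤ ‖x‖ ∧ ‖x‖ ≤ R} with hS
  set O : Set (EuclideanSpace ℝ (Fin 3)) := {x | 1 / 2 < ‖x‖ ∧ ‖x‖ < R} with hO
  have hOS : O ⊆ S := fun x hx => ⟨hx.1.le, hx.2.le⟩
  have hOo : IsOpen O := isOpen_openShell R
  have hSm : MeasurableSet S :=
    ((isClosed_le continuous_const continuous_norm).inter (isClosed_le continuous_norm continuous_const)).measurableSet
  -- the slices are eventually (along `t ↑ 1`) continuous on `S`, so `U₁` is continuous on `S`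
  have hev : ∀ᶠ t in 𝓝[<] (1 : ℝ), ContinuousOn (u t) S := by
    filter_upwards [Ioo_mem_nhdsLT (zero_lt_one' ℝ)] with t ht using hcont t ht
  have hU₁ : ContinuousOn U₁ S := hunif.continuousOn hev.frequently
  -- local integrability of `u 1 - U₁` on the open shell
  have hu1 : MemLp (u 1) 2 volume := hLH.memLp 1 ⟨zero_le_one, le_rfl⟩
  have hu1loc : LocallyIntegrable (u 1) volume := hu1.locallyIntegrable (by norm_num)
  have hloc : LocallyIntegrableOn (fun x => u 1 x - U₁ x) O volume :=
    (hu1loc.locallyIntegrableOn O).sub ((hU₁.mono hOS).locallyIntegrableOn hOo.measurableSet)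
  -- the test-function identity on the open shell
  have htest : ∀ g : EuclideanSpace ℝ (Fin 3) → ℝ, ContDiff ℝ ∞ g → HasCompactSupport g → tsupport g ⊆ O →
      ∫ x, g x • (u 1 x - U₁ x) = 0 := by
    intro g hg hgc hgO
    have hgcont : Continuous g := hg.continuous
    have hgS : tsupport g ⊆ S := hgO.trans hOS
    have hsupp : ∀ φ : EuclideanSpace ℝ (Fin 3) → EuclideanSpace ℝ (Fin 3), support (fun x => g x • φ x) ⊆ tsupport g := by
      intro φ x hx
      by_contra h
      exact hx (by simp only [image_eq_zero_of_notMem_tsupport h, zero_smul])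
    have hint1 : Integrable (fun x => g x • u 1 x) volume :=
      (integrableOn_iff_integrable_of_support_subset (hsupp (u 1))).1
        ((hu1loc.integrableOn_isCompact hgc).continuousOn_smul hgcont.continuousOn hgc)
    have hint2 : Integrable (fun x => g x • U₁ x) volume :=
      (integrableOn_iff_integrable_of_support_subset (hsupp U₁)).1
        (((hU₁.mono hgS).integrableOn_compact hgc).continuousOn_smul hgcont.continuousOn hgc)
    refine integral_smul_sub_eq_zero hint1 hint2 fun e => ?_
    exact tendsto_nhds_unique (tendsto_integral_mul_inner_of_isLerayHopfOn hLH hgcont hgc e)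
      (tendsto_integral_mul_inner_of_tendstoUniformlyOn hev hunif hgcont hgc hgS e)
  -- a.e. on the open shell, then on the closed shell (null spheres)
  have hae : ∀ᵐ x ∂volume, x ∈ O → u 1 x - U₁ x = 0 := hOo.ae_eq_zero_of_integral_contDiff_smul_eq_zero hloc htest
  rw [ae_restrict_iff' hSm]
  filter_upwards [hae, ae_mem_openShell_of_mem_shell R] with x hx hxO hxS
  exact sub_eq_zero.1 (hx (hxO hxS))

/-! ### Plate I32 by name (appended after P0 `CalmPocketDoorDefs` landed) -/

/-- **PLATE I32 BY NAME**: `TerminalValueIdentification` of the door's defs file (P0, Sketch32 v2 :145–150) holds — it is `terminalValue_ae_eq`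
with `shell R` folded. [folklore; cite: Galdi2000, Lemma 2.2] -/
theorem terminalValueIdentification_holds : TerminalValueIdentification :=
  terminalValue_ae_eq

end Summit.NavierStokesRegularity.NavierStokesRegularity.Theorems.CalmPocketDoor

end
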